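import Mathlib.Analysis.SpecialFunctions.Pow.Real
import Mathlib.Algebra.BigOperators.Field

/-!
# EriceRemainderEnclosureHistoryAutonomyComparisonContinuumDirectGauge — (E129) **THE DIRECT NONLINEAR GAUGE FOR THE SHARP STEP: ALGEBRAIC CORE OF
# «(E58′) IN THE CONTINUUM FOR EVERY AMPLITUDE `η ≤ 0.75·Φ₀(A*)` (LEAN-CERTIFIED CONSTANT; `0.90` BY EVALUATING ONE EXPLICIT FUNCTION)».**
# Continuum model of the comparison column (`HOME/b2b-balaban-beta-d4-p2/g100/README.md` §2, `g101/README.md` §5 route (D), this generation's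
# `g102/README.md` §4).  The DIRECT comparison `X = Φ_η − Φ₀` of the sharp-step flow with its base is continuous in the level (kinks at the crossing pins, of
# the helpful sign) — unlike the amplitude derivative `Z^η`, which g102 §3 shows DOES go negative — and obeys, below the threshold and away from the kinks,
#     `X′(α) = Σ_r [m⁰_r∕Φ₀(α) − m^η_r∕Φ_η(α)] = Σ_r (m⁰_r − m^η_r)∕Φ₀(α) + X(α)·M^η(α)∕(Φ₀(α)Φ_η(α))`,   `m^i_r = (L_r∕2)(ℓ^i_r)^{-3∕2}Φ_i(ℓ^i_r)`.
# Two NONLINEAR monotonicity facts replace g101's linearisation (README §4 (a),(b)): at equal times since the threshold the perturbed flow is faster by at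
# least `η`, and at equal times-before-arrival at the pin it is higher, by at most the time-integral of `X` over its window: `ℓ^η_r − ℓ⁰_r ≤ Ξ_r = ∫ X dt_η`.
# With `Φ₀√ℓ` non-decreasing (the top bound `ℓ|Φ₀′| ≤ Φ₀∕2`) and `Φ_η ≥ Φ₀` above the pin (induction) this gives, per block, with `x = α∕ℓ⁰_r`, `y =
# ℓ^η_r∕ℓ⁰_r ∈ [1, 1 + (1−x)ζ]`, `ζ = η∕Φ₀(A*)`, `t = √y`, base share `s_r` (`Σ s_r ≤ 1`):
#     `α·X′ ≤ X · Σ_r s_r·h(x_r, y_r)`,   `h(x,y) = [2x + (y+1)(y² − x²)]∕(4 y^{3∕2})`,   and `h ≤ 24∕25` whenever `y ≤ 7∕4`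
# — so the level gauge `X∕α` strictly decreases going up while `X > 0`, and the continuous induction of g101 §2 (4) (on paper) yields (E58′) for the sharp step
# at every amplitude `η ≤ (3∕4)·Φ₀(A*)` (numerically `max_x h(x, 1+(1−x)ζ) < 1` iff `ζ < 0.901`; g101's route (D) had `0.13`).  THIS FILE is the finite,
# derivative-free part: (§1) **`top_ratio_le`** (the window-top ratio `y ≤ 1 + (1−x)ζ`); (§2) **`weight_deficit_le`** (`(ℓ⁰)^{-3∕2}Φ₀(ℓ⁰) −
# (ℓ^η)^{-3∕2}Φ_η(ℓ^η) ≤ (ℓ⁰)^{-3∕2}Φ₀(ℓ⁰)(1 − y^{-2})`); (§3) **`direct_c2_le`**, **`direct_c1_le`** (the two pieces of `αX′∕X` per block); (§4) **`hpoly_le`**,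
# **`hblock_le`** (`h ≤ 24∕25` on `y ≤ 7∕4`); (§5) **`direct_cost_le`**, **`direct_gauge_decreasing`** (the budget sum and the gauge step `αX′ − X ≤ −X∕25`).

Cell `pub-balaban`, β-function sub-cell, BINDER row D4 «RemainderConst leaves for Bałaban's split» (`HOME/BINDER-OWNERS.md`; owner lineage `b2b-balaban-beta-an4`;
this file by co-owner #2 lineage `b2b-balaban-beta-d4-p2`, generation 102), β-FLOW TEAM duty (1), FREEZE (0) honoured (def-free; imports Mathlib only; restates nothing).

HONEST FRAMING (page 1, verbatim and binding).  *"Discharging BetaPertH makes Bałaban's UV stability UNCONDITIONAL — a real constructive-QFT result; it is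
NOT the continuum limit and NOT the Clay problem."*  THIS FILE DISCHARGES NOTHING OF THE KIND.  Elementary real algebra about abstract reals standing for the
blocks of the cell's continuum model of an abstract flow with memory — hypotheses of a census, not facts; the form, signs, ages and moments of Bałaban's (1.22)
limit functional are NOT PRINTED ([I] p. 298; GAPS G-t4-U2-1∕-2) and NOT asserted.  Row D4 class UNCHANGED (critical-path width 0; instance 0∕1; D4 DISCHARGE NO
DATE).  HONEST DEPENDENCY: continuum YM on T⁴ ⇐ BetaPertH ∧ nine spine estimates (0/9 proved); BetaPertH ⇐ (D1) ∧ (D4) ∧ CAP+tail; G-an2-4 gates asym, D1 and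
NE2/3/4.  NOT CLAIMED: the lattice statement (E58′), amplitudes above `0.9·Φ₀(A*)`, anything printed — NOT B12 Thm 2, NOT BetaPertH, NOT continuum, NOT Clay.

WHAT IS PROVED ([folklore]; 0 `def`, 0 sorry).  §1 **`top_ratio_le`**.  §2 **`weight_deficit_le`**.  §3 **`direct_c2_le`**, **`direct_c1_le`**.  §4 **`hpoly_le`**,
**`hblock_le`**.  §5 **`direct_cost_le`**, **`direct_gauge_decreasing`**.  v1.1 (same unit and generation) APPENDS §6 — the building blocks of the CREDITED route (README
§4 (2),(5)): **`weight_deficit_credit_le`** (the deficit with the gauge's own outflow credit `X(ℓ^η) ≥ η·ℓ^η∕A*`), **`direct_c2_ratio_le`** (the window-shift piece with a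
general speed ratio `ρ` in place of `√y`), **`credit_term_le`**, **`mixed_ratio_le`** (the ratio `Φ₀(ℓ⁰)∕Φ_η(A*⁻) ≤ w^{-1∕2}∕(1+ζ)` of a mixed block) — and modifies NO
existing declaration.
-/

noncomputable section
open Finset Real

namespace Summit.QuantumFields.BalabanUV.Beta.EriceRemainderEnclosureHistoryAutonomyComparisonContinuumDirectGauge

/-! ## §1 The window-top ratio -/

/-- **THE WINDOW-TOP RATIO `y ≤ 1 + (1−x)ζ`.**  Block window from the pin `αs` (`x = αs∕ℓ0`): base top `ℓ0 > 0`, perturbed top `ℓη ≤ ℓ0 + η·k` (the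
perturbed flow is higher at equal times-before-arrival by at most the time-integral of `X ≤ η` over the part of the window below the threshold, of duration
`≤ k`), and `k·Φ ≤ ℓ0 − αs` for a speed `Φ > 0` with `η ≤ ζ·Φ` (in each of the three cases of README §4 (c): `Φ = Φ₀(ℓ0) ≥ Φ₀(A*)` or `Φ = Φ_η(A*⁻)`).  Then
`ℓη∕ℓ0 ≤ 1 + (1 − αs∕ℓ0)·ζ`. [folklore] -/
theorem top_ratio_le {ℓ0 ℓη αs η k Φ ζ : ℝ} (hℓ0 : 0 < ℓ0) (hΦ : 0 < Φ) (hη : 0 ≤ η) (hk : 0 ≤ k) (htop : ℓη ≤ ℓ0 + η * k)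
    (hdur : k * Φ ≤ ℓ0 - αs) (hζ : η ≤ ζ * Φ) : ℓη / ℓ0 ≤ 1 + (1 - αs / ℓ0) * ζ := by
  have h1 : η * k ≤ ζ * (ℓ0 - αs) := by
    calc η * k ≤ ζ * Φ * k := mul_le_mul_of_nonneg_right hζ hk
      _ = ζ * (k * Φ) := by ring
      _ ≤ ζ * (ℓ0 - αs) := by
          have hζ0 : 0 ≤ ζ := by
            have h0 : 0 ≤ ζ * Φ := hη.trans hζ
            nlinarith
          exact mul_le_mul_of_nonneg_left hdur hζ0
  rw [div_le_iff₀ hℓ0]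
  have e : (1 + (1 - αs / ℓ0) * ζ) * ℓ0 = ℓ0 + ζ * (ℓ0 - αs) := by field_simp
  rw [e]; linarith

/-! ## §2 The weight deficit of one block -/

/-- **THE WEIGHT DEFICIT.**  Base top `ℓ0 = r0²`, perturbed top `ℓη = rη²` (`r0, rη > 0`), base speed at the base top `Φ0t`, perturbed speed at the
perturbed top `Φηt ≥ Φ0t·r0∕rη` (from `Φ_η ≥ Φ₀` above the pin and `Φ₀√ℓ` non-decreasing).  Then the block's weight deficit obeys
`Φ0t∕(ℓ0·r0) − Φηt∕(ℓη·rη) ≤ (Φ0t∕(ℓ0·r0))·(1 − ℓ0²∕ℓη²)` (`ℓ^{-3∕2} = 1∕(ℓ·√ℓ)`). [folklore] -/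
theorem weight_deficit_le {ℓ0 ℓη r0 rη Φ0t Φηt : ℝ} (hr0 : 0 < r0) (hrη : 0 < rη) (hℓ0 : r0 ^ 2 = ℓ0) (hℓη : rη ^ 2 = ℓη)
    (hΦηt : Φ0t * r0 / rη ≤ Φηt) :
    Φ0t / (ℓ0 * r0) - Φηt / (ℓη * rη) ≤ Φ0t / (ℓ0 * r0) * (1 - ℓ0 ^ 2 / ℓη ^ 2) := by
  have hℓ0p : 0 < ℓ0 := by rw [← hℓ0]; positivity
  have hℓηp : 0 < ℓη := by rw [← hℓη]; positivity
  have h1 : Φ0t * r0 / rη / (ℓη * rη) ≤ Φηt / (ℓη * rη) := div_le_div_of_nonneg_right hΦηt (by positivity)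
  have e : Φ0t * r0 / rη / (ℓη * rη) = Φ0t / (ℓ0 * r0) * (ℓ0 ^ 2 / ℓη ^ 2) := by
    rw [← hℓ0, ← hℓη]; field_simp
  rw [e] at h1
  linarith

/-! ## §3 The two pieces of `αX′∕X` per block -/

/-- **THE WINDOW-SHIFT PIECE `c2`.**  Block with base share `s = L∕(r0·Φ0a)` at the pin `α > 0` (`Φ0a = Φ₀(α) > 0`, `L ≥ 0`), base top `ℓ0 = r0² ≥ α`,
`x = α∕ℓ0`, ratio `y = ℓη∕ℓ0 ≥ 1`, `t² = y`, `t > 0`.  Hypotheses (README §4 (b)–(d)): the deficit bound of `weight_deficit_le` in the form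
`D ≤ (Φ0t∕(ℓ0·r0))·(1 − 1∕y²)` (`Φ0t ≥ 0` the base speed at the base top); `y − 1 ≤ Ξ∕ℓ0` (the tops differ by at most the time-integral `Ξ` of `X` over the
perturbed window); the GAUGE window bound `Ξ ≤ (X∕α)·Q∕(2Φ̂)` with `Q ≤ ℓ0²(y² − x²)` (`Q = ℓ̂² − α²`, `ℓ̂ = ℓ^η ∧ A*`), `Φ̂ > 0` the perturbed speed at `ℓ̂` and
`Φ0t ≤ t·Φ̂`; `X ≥ 0`.  Then the block's contribution `α·(L∕2)·D∕Φ0a` to `αX′` is at most `X·(s∕4)·(y+1)(y²−x²)∕(y·t)`. [folklore] -/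
theorem direct_c2_le {α ℓ0 r0 L s Φ0a Φ0t Φh D y t x Ξ Q X : ℝ} (hα : 0 < α) (hr0 : 0 < r0) (hℓ0 : r0 ^ 2 = ℓ0) (hαℓ : α ≤ ℓ0) (hΦ0a : 0 < Φ0a)
    (hL : 0 ≤ L) (hs : s = L / (r0 * Φ0a)) (hx : x = α / ℓ0) (hy1 : 1 ≤ y) (ht : 0 < t) (hty : t ^ 2 = y) (hΦ0t : 0 ≤ Φ0t) (hΦh : 0 < Φh)
    (hΦ0th : Φ0t ≤ t * Φh) (hX : 0 ≤ X) (hD : D ≤ Φ0t / (ℓ0 * r0) * (1 - 1 / y ^ 2)) (hyΞ : y - 1 ≤ Ξ / ℓ0) (hΞ : Ξ ≤ X / α * Q / (2 * Φh))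
    (hQ : Q ≤ ℓ0 ^ 2 * (y ^ 2 - x ^ 2)) :
    α * (L / 2) * D / Φ0a ≤ X * (s / 4) * ((y + 1) * (y ^ 2 - x ^ 2) / (y * t)) := by
  have hℓ0p : 0 < ℓ0 := by rw [← hℓ0]; positivity
  have hy0 : 0 < y := by linarith
  have hx1 : x ≤ 1 := by rw [hx, div_le_one hℓ0p]; exact hαℓ
  have hx0 : 0 ≤ x := by rw [hx]; positivity
  have hyx : 0 ≤ y ^ 2 - x ^ 2 := by nlinarith
  -- y - 1 ≤ (X/α)·ℓ0(y²−x²)/(2Φ̂)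
  have hXα : 0 ≤ X / α := div_nonneg hX hα.le
  have hy1' : y - 1 ≤ X / α * (ℓ0 * (y ^ 2 - x ^ 2)) / (2 * Φh) := by
    have h2 : X / α * Q / (2 * Φh) ≤ X / α * (ℓ0 ^ 2 * (y ^ 2 - x ^ 2)) / (2 * Φh) :=
      div_le_div_of_nonneg_right (mul_le_mul_of_nonneg_left hQ hXα) (by positivity)
    have h3 : Ξ / ℓ0 ≤ X / α * (ℓ0 ^ 2 * (y ^ 2 - x ^ 2)) / (2 * Φh) / ℓ0 := div_le_div_of_nonneg_right (hΞ.trans h2) hℓ0p.le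
    have e : X / α * (ℓ0 ^ 2 * (y ^ 2 - x ^ 2)) / (2 * Φh) / ℓ0 = X / α * (ℓ0 * (y ^ 2 - x ^ 2)) / (2 * Φh) := by
      field_simp
    linarith [hyΞ, h3, e.le, e.ge]
  have hfac : 0 ≤ Φ0t / (ℓ0 * r0) * ((y + 1) / y ^ 2) := by positivity
  have hD' : D ≤ Φ0t / (ℓ0 * r0) * ((y + 1) / y ^ 2) * (y - 1) := by
    have e : Φ0t / (ℓ0 * r0) * (1 - 1 / y ^ 2) = Φ0t / (ℓ0 * r0) * ((y + 1) / y ^ 2) * (y - 1) := by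
      field_simp
      ring
    linarith [hD, e.le, e.ge]
  have hD'' : D ≤ Φ0t / (ℓ0 * r0) * ((y + 1) / y ^ 2) * (X / α * (ℓ0 * (y ^ 2 - x ^ 2)) / (2 * Φh)) :=
    hD'.trans (mul_le_mul_of_nonneg_left hy1' hfac)
  have hcoef : 0 ≤ α * (L / 2) / Φ0a := by positivity
  have step1 : α * (L / 2) * D / Φ0a ≤ α * (L / 2) / Φ0a * (Φ0t / (ℓ0 * r0) * ((y + 1) / y ^ 2) * (X / α * (ℓ0 * (y ^ 2 - x ^ 2)) / (2 * Φh))) := by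
    have e : α * (L / 2) * D / Φ0a = α * (L / 2) / Φ0a * D := by ring
    rw [e]; exact mul_le_mul_of_nonneg_left hD'' hcoef
  have e2 : α * (L / 2) / Φ0a * (Φ0t / (ℓ0 * r0) * ((y + 1) / y ^ 2) * (X / α * (ℓ0 * (y ^ 2 - x ^ 2)) / (2 * Φh)))
      = X * (s / 4) * ((y + 1) * (y ^ 2 - x ^ 2) / y ^ 2) * (Φ0t / Φh) := by
    rw [hs]; field_simp; ring
  have hs0 : 0 ≤ s := by rw [hs]; positivity
  have hmid : 0 ≤ X * (s / 4) * ((y + 1) * (y ^ 2 - x ^ 2) / y ^ 2) := by positivity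
  have hrat : Φ0t / Φh ≤ t := by rw [div_le_iff₀ hΦh]; exact hΦ0th
  have step2 : X * (s / 4) * ((y + 1) * (y ^ 2 - x ^ 2) / y ^ 2) * (Φ0t / Φh) ≤ X * (s / 4) * ((y + 1) * (y ^ 2 - x ^ 2) / y ^ 2) * t :=
    mul_le_mul_of_nonneg_left hrat hmid
  have e3 : X * (s / 4) * ((y + 1) * (y ^ 2 - x ^ 2) / y ^ 2) * t = X * (s / 4) * ((y + 1) * (y ^ 2 - x ^ 2) / (y * t)) := by
    have hy2 : y ^ 2 = y * t * t := by rw [← hty]; ring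
    rw [hy2]; field_simp
  linarith [step1, step2, e2.le, e2.ge, e3.le, e3.ge]

/-- **THE INFLOW PIECE `c1`.**  Same block: perturbed top `ℓη = y·ℓ0` with root `rη = r0·t`, perturbed weight `mη = (L∕2)·Φηt∕(ℓη·rη)` with `Φηt ≤ Φηa`
(the perturbed speed is non-increasing in the level; `Φηa = Φ_η(α) > 0`).  Then `α·mη∕(Φ0a·Φηa) ≤ (s∕2)·x∕(y·t)` — the perturbed share is `s∕t` and the
level ratio `α∕ℓη = x∕y`. [folklore] -/
theorem direct_c1_le {α ℓ0 ℓη r0 rη L s Φ0a Φηa Φηt mη y t x : ℝ} (hα : 0 < α) (hr0 : 0 < r0) (hℓ0 : r0 ^ 2 = ℓ0) (hΦ0a : 0 < Φ0a) (hΦηa : 0 < Φηa)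
    (hL : 0 ≤ L) (hs : s = L / (r0 * Φ0a)) (hx : x = α / ℓ0) (hy0 : 0 < y) (ht : 0 < t) (hℓη : ℓη = y * ℓ0) (hrη : rη = r0 * t)
    (hm : mη = L / 2 * (Φηt / (ℓη * rη))) (hΦηt : Φηt ≤ Φηa) :
    α * mη / (Φ0a * Φηa) ≤ s / 2 * (x / (y * t)) := by
  have hℓ0p : 0 < ℓ0 := by rw [← hℓ0]; positivity
  have hℓηp : 0 < ℓη := by rw [hℓη]; positivity
  have hrηp : 0 < rη := by rw [hrη]; positivity
  have h1 : α * mη / (Φ0a * Φηa) = (α * (L / 2) / (ℓη * rη * Φ0a)) * (Φηt / Φηa) := by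
    rw [hm]; field_simp
  have h2 : Φηt / Φηa ≤ 1 := (div_le_one hΦηa).mpr hΦηt
  have hc : 0 ≤ α * (L / 2) / (ℓη * rη * Φ0a) := by positivity
  have h3 : α * (L / 2) / (ℓη * rη * Φ0a) * (Φηt / Φηa) ≤ α * (L / 2) / (ℓη * rη * Φ0a) * 1 := mul_le_mul_of_nonneg_left h2 hc
  have e : α * (L / 2) / (ℓη * rη * Φ0a) = s / 2 * (x / (y * t)) := by
    rw [hs, hx, hℓη, hrη]; field_simp
  rw [h1]; linarith [h3, e.le, e.ge]

/-! ## §4 The per-block bound `h(x,y) ≤ 24∕25` on `y ≤ 7∕4` -/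

/-- `2x + (t²+1)(t⁴ − x²) ≤ (24∕25)·4t³` for `x ≤ 1 ≤ t`, `t² ≤ 7∕4` — i.e. `h(x,y) = [2x + (y+1)(y²−x²)]∕(4y^{3∕2}) ≤ 24∕25` for `y = t² ∈ [1, 7∕4]`
(numerically `max_x h = 0.9487` at `y = 7∕4`, `= 5∕8` at `y = 1`, and `max_x h(x, y) < 1` iff `y < 1.84`). [folklore] -/
theorem hpoly_le {x t : ℝ} (hx1 : x ≤ 1) (ht1 : 1 ≤ t) (ht : t ^ 2 ≤ 7 / 4) :
    2 * x + (t ^ 2 + 1) * (t ^ 4 - x ^ 2) ≤ 24 / 25 * (4 * t ^ 3) := by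
  nlinarith [mul_nonneg (sub_nonneg.mpr ht1) (sub_nonneg.mpr ht), sq_nonneg (x * (t ^ 2 + 1) - 1), sq_nonneg (t - 1),
    mul_nonneg (sub_nonneg.mpr ht1) (sub_nonneg.mpr hx1), mul_nonneg (mul_nonneg (sub_nonneg.mpr ht1) (sub_nonneg.mpr ht1)) (sub_nonneg.mpr ht)]

/-- **`h ≤ 24∕25`.**  For `x ≤ 1 ≤ y ≤ 7∕4`, `t > 0`, `t² = y`: `(1∕2)·x∕(y·t) + (1∕4)·(y+1)(y²−x²)∕(y·t) ≤ 24∕25` — the sum of the two pieces of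
`direct_c1_le` ∕ `direct_c2_le` per unit share. [folklore] -/
theorem hblock_le {x y t : ℝ} (hx1 : x ≤ 1) (hy1 : 1 ≤ y) (hy : y ≤ 7 / 4) (ht : 0 < t) (hty : t ^ 2 = y) :
    1 / 2 * (x / (y * t)) + 1 / 4 * ((y + 1) * (y ^ 2 - x ^ 2) / (y * t)) ≤ 24 / 25 := by
  have ht1 : 1 ≤ t := by nlinarith
  have ht2 : t ^ 2 ≤ 7 / 4 := by rw [hty]; exact hy
  have hp := hpoly_le hx1 ht1 ht2
  have e : 1 / 2 * (x / (y * t)) + 1 / 4 * ((y + 1) * (y ^ 2 - x ^ 2) / (y * t)) = (2 * x + (t ^ 2 + 1) * (t ^ 4 - x ^ 2)) / (4 * t ^ 3) := by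
    rw [← hty]; field_simp; ring
  rw [e, div_le_iff₀ (by positivity)]
  linarith

/-! ## §5 The budget sum and the gauge step -/

variable {ι : Type*}

/-- **THE DIRECT COST IS AT MOST `24∕25`.**  Blocks `r ∈ S` at the pin with base shares `s_r ≥ 0`, `Σ s_r ≤ 1` (the base budget at the pin), each with
`x_r ≤ 1 ≤ y_r ≤ 7∕4`, `t_r > 0`, `t_r² = y_r`, and per-block pieces bounded as in `direct_c1_le` ∕ `direct_c2_le`:
`c1_r ≤ (s_r∕2)·x_r∕(y_rt_r)`, `c2_r ≤ (s_r∕4)(y_r+1)(y_r²−x_r²)∕(y_rt_r)`.  Then `Σ_r (c1_r + c2_r) ≤ 24∕25`. [folklore] -/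
theorem direct_cost_le (S : Finset ι) {s x y t c1 c2 : ι → ℝ} (hs : ∀ r ∈ S, 0 ≤ s r) (hsum : ∑ r ∈ S, s r ≤ 1)
    (hx1 : ∀ r ∈ S, x r ≤ 1) (hy1 : ∀ r ∈ S, 1 ≤ y r) (hy : ∀ r ∈ S, y r ≤ 7 / 4) (ht : ∀ r ∈ S, 0 < t r) (hty : ∀ r ∈ S, t r ^ 2 = y r)
    (hc1 : ∀ r ∈ S, c1 r ≤ s r / 2 * (x r / (y r * t r))) (hc2 : ∀ r ∈ S, c2 r ≤ s r / 4 * ((y r + 1) * (y r ^ 2 - x r ^ 2) / (y r * t r))) :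
    ∑ r ∈ S, (c1 r + c2 r) ≤ 24 / 25 := by
  have hterm : ∀ r ∈ S, c1 r + c2 r ≤ s r * (24 / 25) := by
    intro r hr
    have hb := hblock_le (hx1 r hr) (hy1 r hr) (hy r hr) (ht r hr) (hty r hr)
    have e : s r / 2 * (x r / (y r * t r)) + s r / 4 * ((y r + 1) * (y r ^ 2 - x r ^ 2) / (y r * t r))
        = s r * (1 / 2 * (x r / (y r * t r)) + 1 / 4 * ((y r + 1) * (y r ^ 2 - x r ^ 2) / (y r * t r))) := by ring
    have := mul_le_mul_of_nonneg_left hb (hs r hr)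
    linarith [hc1 r hr, hc2 r hr, e.le, e.ge]
  calc ∑ r ∈ S, (c1 r + c2 r) ≤ ∑ r ∈ S, s r * (24 / 25) := sum_le_sum hterm
    _ = (∑ r ∈ S, s r) * (24 / 25) := by rw [sum_mul]
    _ ≤ 1 * (24 / 25) := mul_le_mul_of_nonneg_right hsum (by norm_num)
    _ = 24 / 25 := one_mul _

/-- **THE GAUGE STEP.**  If `α·X′ ≤ X·C` (the derivative identity of README §4 (b) with its two pieces summed: `C = Σ_r (c1_r + c2_r)`), `C ≤ 24∕25`
(`direct_cost_le`) and `X ≥ 0` at the pin, then `α·X′ − X ≤ −X∕25`: the level gauge `X∕α` strictly decreases going up while `X > 0` — the inequality the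
continuous induction of README §4 (e) propagates from the threshold down to every pin, for every amplitude `η ≤ (3∕4)·Φ₀(A*)`. [folklore] -/
theorem direct_gauge_decreasing {α X Xp C : ℝ} (hXp : α * Xp ≤ X * C) (hC : C ≤ 24 / 25) (hX : 0 ≤ X) : α * Xp - X ≤ -(1 / 25) * X := by
  have := mul_le_mul_of_nonneg_left hC hX
  linarith

/-! ## §6 (v1.1) Building blocks of the credited route -/

/-- **THE WEIGHT DEFICIT WITH THE OUTFLOW CREDIT.**  As `weight_deficit_le`, but keeping a credit `κ ≥ 0` in the perturbed speed at the perturbed top: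
`Φηt ≥ Φ0t·r0∕rη + κ` (for a crossed block the gauge's own lower bound above the pin gives `κ = η·ℓη∕A*`, README §4 (2)).  Then
`Φ0t∕(ℓ0·r0) − Φηt∕(ℓη·rη) ≤ (Φ0t∕(ℓ0·r0))·(1 − ℓ0²∕ℓη²) − κ∕(ℓη·rη)`. [folklore] -/
theorem weight_deficit_credit_le {ℓ0 ℓη r0 rη Φ0t Φηt κ : ℝ} (hr0 : 0 < r0) (hrη : 0 < rη) (hℓ0 : r0 ^ 2 = ℓ0) (hℓη : rη ^ 2 = ℓη)
    (hΦηt : Φ0t * r0 / rη + κ ≤ Φηt) :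
    Φ0t / (ℓ0 * r0) - Φηt / (ℓη * rη) ≤ Φ0t / (ℓ0 * r0) * (1 - ℓ0 ^ 2 / ℓη ^ 2) - κ / (ℓη * rη) := by
  have hℓ0p : 0 < ℓ0 := by rw [← hℓ0]; positivity
  have hℓηp : 0 < ℓη := by rw [← hℓη]; positivity
  have h1 : (Φ0t * r0 / rη + κ) / (ℓη * rη) ≤ Φηt / (ℓη * rη) := div_le_div_of_nonneg_right hΦηt (by positivity)
  have e : (Φ0t * r0 / rη + κ) / (ℓη * rη) = Φ0t / (ℓ0 * r0) * (ℓ0 ^ 2 / ℓη ^ 2) + κ / (ℓη * rη) := by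
    rw [← hℓ0, ← hℓη]; field_simp
  rw [e] at h1
  linarith

/-- **THE WINDOW-SHIFT PIECE WITH A GENERAL SPEED RATIO.**  As `direct_c2_le`, with the hypothesis `Φ0t ≤ ρ·Φ̂` for an arbitrary ratio `ρ` in place of `Φ0t ≤ t·Φ̂`
(`ρ = √y` is the plain route; `ρ = √y∕(1 + ζ₀w y^{3∕2})` the credited route for a crossed block; `ρ = w^{-1∕2}∕(1+ζ)` for a mixed block, `mixed_ratio_le`): the block's
contribution `α·(L∕2)·D∕Φ0a` to `αX′` is at most `X·(s∕4)·ρ·(y+1)(y²−x²)∕y²`. [folklore] -/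
theorem direct_c2_ratio_le {α ℓ0 r0 L s Φ0a Φ0t Φh D y x Ξ Q X ρ : ℝ} (hα : 0 < α) (hr0 : 0 < r0) (hℓ0 : r0 ^ 2 = ℓ0) (hαℓ : α ≤ ℓ0) (hΦ0a : 0 < Φ0a)
    (hL : 0 ≤ L) (hs : s = L / (r0 * Φ0a)) (hx : x = α / ℓ0) (hy1 : 1 ≤ y) (hΦ0t : 0 ≤ Φ0t) (hΦh : 0 < Φh)
    (hΦ0th : Φ0t ≤ ρ * Φh) (hX : 0 ≤ X) (hD : D ≤ Φ0t / (ℓ0 * r0) * (1 - 1 / y ^ 2)) (hyΞ : y - 1 ≤ Ξ / ℓ0) (hΞ : Ξ ≤ X / α * Q / (2 * Φh))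
    (hQ : Q ≤ ℓ0 ^ 2 * (y ^ 2 - x ^ 2)) :
    α * (L / 2) * D / Φ0a ≤ X * (s / 4) * (ρ * ((y + 1) * (y ^ 2 - x ^ 2) / y ^ 2)) := by
  have hℓ0p : 0 < ℓ0 := by rw [← hℓ0]; positivity
  have hy0 : 0 < y := by linarith
  have hx1 : x ≤ 1 := by rw [hx, div_le_one hℓ0p]; exact hαℓ
  have hx0 : 0 ≤ x := by rw [hx]; positivity
  have hyx : 0 ≤ y ^ 2 - x ^ 2 := by nlinarith
  have hXα : 0 ≤ X / α := div_nonneg hX hα.le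
  have hy1' : y - 1 ≤ X / α * (ℓ0 * (y ^ 2 - x ^ 2)) / (2 * Φh) := by
    have h2 : X / α * Q / (2 * Φh) ≤ X / α * (ℓ0 ^ 2 * (y ^ 2 - x ^ 2)) / (2 * Φh) :=
      div_le_div_of_nonneg_right (mul_le_mul_of_nonneg_left hQ hXα) (by positivity)
    have h3 : Ξ / ℓ0 ≤ X / α * (ℓ0 ^ 2 * (y ^ 2 - x ^ 2)) / (2 * Φh) / ℓ0 := div_le_div_of_nonneg_right (hΞ.trans h2) hℓ0p.le
    have e : X / α * (ℓ0 ^ 2 * (y ^ 2 - x ^ 2)) / (2 * Φh) / ℓ0 = X / α * (ℓ0 * (y ^ 2 - x ^ 2)) / (2 * Φh) := by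
      field_simp
    linarith [hyΞ, h3, e.le, e.ge]
  have hfac : 0 ≤ Φ0t / (ℓ0 * r0) * ((y + 1) / y ^ 2) := by positivity
  have hD' : D ≤ Φ0t / (ℓ0 * r0) * ((y + 1) / y ^ 2) * (y - 1) := by
    have e : Φ0t / (ℓ0 * r0) * (1 - 1 / y ^ 2) = Φ0t / (ℓ0 * r0) * ((y + 1) / y ^ 2) * (y - 1) := by
      field_simp
      ring
    linarith [hD, e.le, e.ge]
  have hD'' : D ≤ Φ0t / (ℓ0 * r0) * ((y + 1) / y ^ 2) * (X / α * (ℓ0 * (y ^ 2 - x ^ 2)) / (2 * Φh)) :=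
    hD'.trans (mul_le_mul_of_nonneg_left hy1' hfac)
  have hcoef : 0 ≤ α * (L / 2) / Φ0a := by positivity
  have step1 : α * (L / 2) * D / Φ0a ≤ α * (L / 2) / Φ0a * (Φ0t / (ℓ0 * r0) * ((y + 1) / y ^ 2) * (X / α * (ℓ0 * (y ^ 2 - x ^ 2)) / (2 * Φh))) := by
    have e : α * (L / 2) * D / Φ0a = α * (L / 2) / Φ0a * D := by ring
    rw [e]; exact mul_le_mul_of_nonneg_left hD'' hcoef
  have e2 : α * (L / 2) / Φ0a * (Φ0t / (ℓ0 * r0) * ((y + 1) / y ^ 2) * (X / α * (ℓ0 * (y ^ 2 - x ^ 2)) / (2 * Φh)))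
      = X * (s / 4) * ((y + 1) * (y ^ 2 - x ^ 2) / y ^ 2) * (Φ0t / Φh) := by
    rw [hs]; field_simp; ring
  have hs0 : 0 ≤ s := by rw [hs]; positivity
  have hmid : 0 ≤ X * (s / 4) * ((y + 1) * (y ^ 2 - x ^ 2) / y ^ 2) := by positivity
  have hrat : Φ0t / Φh ≤ ρ := by rw [div_le_iff₀ hΦh]; exact hΦ0th
  have step2 : X * (s / 4) * ((y + 1) * (y ^ 2 - x ^ 2) / y ^ 2) * (Φ0t / Φh) ≤ X * (s / 4) * ((y + 1) * (y ^ 2 - x ^ 2) / y ^ 2) * ρ :=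
    mul_le_mul_of_nonneg_left hrat hmid
  have e3 : X * (s / 4) * ((y + 1) * (y ^ 2 - x ^ 2) / y ^ 2) * ρ = X * (s / 4) * (ρ * ((y + 1) * (y ^ 2 - x ^ 2) / y ^ 2)) := by ring
  linarith [step1, step2, e2.le, e2.ge, e3.le, e3.ge]

/-- **THE CREDIT TERM.**  The credit `κ = η·ℓη∕A*` of `weight_deficit_credit_le` contributes `−α·(L∕2)·(κ∕(ℓη·rη))∕Φ0a` to `αX′`; with `ℓη = y·ℓ0`, `rη = r0·t`
(`t² = y`), `w = ℓ0∕A*` and `X ≤ η` (the response never exceeds the source) this is at most `−X·(s∕2)·x·w∕t`, `s = L∕(r0·Φ0a)`, `x = α∕ℓ0`. [folklore] -/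
theorem credit_term_le {α ℓ0 ℓη r0 rη L s Φ0a A η X y t x w κ : ℝ} (hα : 0 < α) (hr0 : 0 < r0) (hℓ0 : r0 ^ 2 = ℓ0) (hΦ0a : 0 < Φ0a) (hA : 0 < A)
    (hL : 0 ≤ L) (hs : s = L / (r0 * Φ0a)) (hx : x = α / ℓ0) (hy0 : 0 < y) (ht : 0 < t) (hℓη : ℓη = y * ℓ0) (hrη : rη = r0 * t)
    (hw : w = ℓ0 / A) (hκ : κ = η * ℓη / A) (hXη : X ≤ η) :
    -(α * (L / 2) * (κ / (ℓη * rη)) / Φ0a) ≤ -(X * (s / 2) * (x * w / t)) := by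
  have hℓ0p : 0 < ℓ0 := by rw [← hℓ0]; positivity
  have e : α * (L / 2) * (κ / (ℓη * rη)) / Φ0a = η * (s / 2) * (x * w / t) := by
    rw [hκ, hs, hx, hw, hℓη, hrη]; field_simp
  have hc : 0 ≤ s / 2 * (x * w / t) := by rw [hs, hx, hw]; positivity
  rw [e]; linarith [mul_le_mul_of_nonneg_right hXη hc]

/-- **THE SPEED RATIO OF A MIXED BLOCK.**  Base top `ℓ0 = r0²` below the threshold `A = rA²` (`r0 ≤ rA`), base speed there `Φ0t` with `Φ0t·r0 ≤ Φ0A·rA` (`Φ₀√ℓ`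
non-decreasing), perturbed speed just below the threshold `ΦAm = Φ0A·(1+ζ)` (`Φ0A > 0`, `ζ ≥ 0`).  Then `Φ0t ≤ ((rA∕r0)∕(1+ζ))·ΦAm` — the ratio `ρ = w^{-1∕2}∕(1+ζ)` of
README §4 (5) class (II), to be fed to `direct_c2_ratio_le`. [folklore] -/
theorem mixed_ratio_le {r0 rA Φ0t Φ0A ΦAm ζ : ℝ} (hr0 : 0 < r0) (hΦ0A : 0 < Φ0A) (hζ : 0 ≤ ζ) (hmono : Φ0t * r0 ≤ Φ0A * rA) (hΦAm : ΦAm = Φ0A * (1 + ζ)) :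
    Φ0t ≤ rA / r0 / (1 + ζ) * ΦAm := by
  have h1 : Φ0t ≤ Φ0A * rA / r0 := by rw [le_div_iff₀ hr0]; linarith
  have e : rA / r0 / (1 + ζ) * ΦAm = Φ0A * rA / r0 := by
    rw [hΦAm]; field_simp
  rw [e]; exact h1

end Summit.QuantumFields.BalabanUV.Beta.EriceRemainderEnclosureHistoryAutonomyComparisonContinuumDirectGauge

end
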